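import Mathlib.Analysis.InnerProductSpace.Dual
import Literature.Analysis.FluidPDE.TaoCascadeDuhamel

/-!
# Stub B (`bilinearOperator`) for `PerpetualPump.Thesis`, part II: the divergence-free subspace
# and the `H⁹` bootstrap

Support file (part 2 of the stub `bilinearOperator` of line `SketchIdeator2`, crux
stmt-NavierStokesRegularity-1832). Tao's averaged operator `B̃(u,v)` (J. Amer. Math. Soc. 29
(2016), arXiv:1402.0290v3, (1.12)–(1.14)) is *defined by duality*; to realise it as an honest
`L²`-valued operator we use the Riesz representation on the closed subspace
`L²_σ = {f ∈ L²(ℝ³; ℂ³) : ξ · f̂(ξ) = 0 a.e.}` of divergence-free fields. This file supplies the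
Hilbert-space half of that construction, with no reference to the averaging datum:

* `completeSpace_of_mem_iff_isFourierDivFree` — any `ℂ`-submodule of `L²` whose carrier is
  exactly the divergence-free fields is complete (it is the joint kernel of the bounded
  functionals `f ↦ ⟪Φ_φ, 𝓕f⟫` of the tree's `TaoMultiplierToolkit.lean`, hence closed);
* `eFourierSobolevNorm_nine_le_of_inner_bound` (registered sub-goal `stub_bilinearOperator_S`) —
  **the `H⁹` bootstrap**: if `z` is divergence free and `|⟪z, w⟫| ≤ K ‖w‖_{H⁻⁹}` for every
  divergence-free `w ∈ L²`, then `‖z‖_{H⁹} ≤ K`. Proof: test against `w = J_N z`, `J_N` the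
  scalar Fourier multiplier with the truncated weight `min((1+|ξ|²)⁹, N)` (bounded, so `J_N` acts
  on `L²` and preserves divergence-freeness); then `I_N = ∫ min((1+|ξ|²)⁹, N)|ẑ|² = ⟪z, J_N z⟫`
  and `‖J_N z‖²_{H⁻⁹} ≤ I_N`, so `I_N ≤ K I_N^{1/2}`, `I_N ≤ K²`, and `N → ∞` (monotone
  convergence) gives `‖z‖²_{H⁹} ≤ K²`. No Leray projection formula is needed;
* the Sobolev norms of conjugates and real parts (`eFourierSobolevNorm_conjL2`,
  `eFourierSobolevNorm_reL2_le`) and the divergence-freeness / additivity / real homogeneity of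
  `Re` (`isFourierDivFree_conjL2`, `isFourierDivFree_reL2`, `reL2_add`, `reL2_smul_real`).

## References

* T. Tao, J. Amer. Math. Soc. 29 (2016), 601–674, arXiv:1402.0290v3, §1.1 (1.12)–(1.14).
-/

noncomputable section

open MeasureTheory Set Filter Topology FourierTransform
open scoped ENNReal NNReal ComplexConjugate InnerProductSpace

set_option linter.dupNamespace false

namespace Summit.NavierStokesRegularity.NavierStokesRegularity.Theorems.PerpetualPumpThesis.B

open Literature.Analysis.FluidPDE Literature.Analysis.FluidPDE.Tao2016
open Literature.Analysis.FunctionSpaces (eFourierSobolevNorm)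

/-! ### The divergence-free subspace is closed -/

/-- The test functional `f ↦ ⟪Φ_φ, 𝓕f⟫` of the tree's divergence-free calculus is continuous on `L²`. -/
theorem continuous_inner_divTestVec_fourier {φ : EuclideanSpace ℝ (Fin 3) → ℂ}
    (hφ : MemLp φ 2 (volume : Measure (EuclideanSpace ℝ (Fin 3)))) :
    Continuous fun f : L2C => ⟪((memLp_divTestVec hφ).toLp _ : L2C), (𝓕 f : L2C)⟫_ℂ :=
  continuous_const.inner (continuous_fourier (E := L2C))

/-- **The divergence-free fields form a closed subset of `L²(ℝ³; ℂ³)`**: they are the joint kernel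
of the continuous functionals `f ↦ ⟪Φ_φ, 𝓕f⟫`, `φ ∈ L²(ℝ³; ℂ)`. -/
theorem isClosed_setOf_isFourierDivFree : IsClosed {f : L2C | IsFourierDivFree f} := by
  have h : {f : L2C | IsFourierDivFree f} =
      ⋂ φ : {φ : EuclideanSpace ℝ (Fin 3) → ℂ // MemLp φ 2 (volume : Measure (EuclideanSpace ℝ (Fin 3)))},
        (fun f : L2C => ⟪((memLp_divTestVec φ.2).toLp _ : L2C), (𝓕 f : L2C)⟫_ℂ) ⁻¹' {0} := by
    ext f
    simp only [Set.mem_setOf_eq, Set.mem_iInter, Set.mem_preimage, Set.mem_singleton_iff]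
    exact ⟨fun hf φ => hf.inner_divTestVec_eq_zero φ.2,
      fun hf => isFourierDivFree_of_forall_inner_divTestVec fun φ hφ => hf ⟨φ, hφ⟩⟩
  rw [h]
  exact isClosed_iInter fun φ =>
    (isClosed_singleton.preimage (continuous_inner_divTestVec_fourier φ.2))

/-- **`L²_σ` is a Hilbert space**: a `ℂ`-submodule of `L²(ℝ³; ℂ³)` whose elements are exactly the
divergence-free fields is complete (closed in the complete space `L²`). -/
theorem completeSpace_of_mem_iff_isFourierDivFree (K : Submodule ℂ L2C)
    (hK : ∀ f : L2C, f ∈ K ↔ IsFourierDivFree f) : CompleteSpace K := by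
  have hc : IsClosed (K : Set L2C) := by
    have h : (K : Set L2C) = {f : L2C | IsFourierDivFree f} := Set.ext fun f => hK f
    rw [h]
    exact isClosed_setOf_isFourierDivFree
  exact hc.isComplete.completeSpace_coe

/-- **`L²_σ` exists as a `ℂ`-submodule**: the divergence-free fields are closed under `0`, `+` and
complex scalars. -/
theorem exists_submodule_mem_iff_isFourierDivFree :
    ∃ K : Submodule ℂ L2C, ∀ f : L2C, f ∈ K ↔ IsFourierDivFree f :=
  ⟨{ carrier := {f | IsFourierDivFree f}
     add_mem' := fun hf hg => hf.add hg
     zero_mem' := memH10df_zero.2.2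
     smul_mem' := fun c _ hf => hf.smul c }, fun _ => Iff.rfl⟩

/-! ### The `H⁹` bootstrap -/

/-- Plancherel in `ℝ≥0∞`: `∫ ‖ẑ‖² = ‖z‖²`. -/
theorem lintegral_enorm_sq_fourierFn (z : L2C) : ∫⁻ ξ, ‖fourierFn z ξ‖ₑ ^ 2 = ‖z‖ₑ ^ 2 := by
  rw [← lintegral_enorm_sq_fourierFn_rpow_eq, ← ENNReal.rpow_natCast, ← ENNReal.rpow_mul]
  norm_num

/-- The truncated weight `min((1+|ξ|²)⁹, N)` is continuous. -/
theorem continuous_truncWeight (N : ℕ) :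
    Continuous fun ξ : EuclideanSpace ℝ (Fin 3) => min ((1 + ‖ξ‖ ^ 2) ^ 9) (N : ℝ) := by
  fun_prop

/-- The truncated weight is nonnegative. -/
theorem truncWeight_nonneg (N : ℕ) (ξ : EuclideanSpace ℝ (Fin 3)) :
    0 ≤ min ((1 + ‖ξ‖ ^ 2) ^ 9) (N : ℝ) :=
  le_min (by positivity) N.cast_nonneg

/-- The truncated weight, as a complex symbol, is essentially bounded (by `N`). -/
theorem memLp_top_truncWeight (N : ℕ) :
    MemLp (fun ξ : EuclideanSpace ℝ (Fin 3) => ((min ((1 + ‖ξ‖ ^ 2) ^ 9) (N : ℝ) : ℝ) : ℂ)) ∞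
      (volume : Measure (EuclideanSpace ℝ (Fin 3))) := by
  refine memLp_top_of_bound (Complex.continuous_ofReal.comp (continuous_truncWeight N)).aestronglyMeasurable
    N (Eventually.of_forall fun ξ => ?_)
  simp only [Complex.norm_real, Real.norm_eq_abs, abs_of_nonneg (truncWeight_nonneg N ξ)]
  exact min_le_right _ _

/-- The truncated `H⁹` energy `I_N = ∫ min((1+|ξ|²)⁹, N) |ẑ|²` is finite (`≤ N ‖z‖²`). -/
theorem truncEnergy_lt_top (N : ℕ) (z : L2C) :
    ∫⁻ ξ, ENNReal.ofReal (min ((1 + ‖ξ‖ ^ 2) ^ 9) (N : ℝ)) * ‖fourierFn z ξ‖ₑ ^ 2 < ∞ := by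
  calc ∫⁻ ξ, ENNReal.ofReal (min ((1 + ‖ξ‖ ^ 2) ^ 9) (N : ℝ)) * ‖fourierFn z ξ‖ₑ ^ 2
      ≤ ∫⁻ ξ, (N : ℝ≥0∞) * ‖fourierFn z ξ‖ₑ ^ 2 := by
        refine lintegral_mono fun ξ => mul_le_mul' ?_ le_rfl
        calc ENNReal.ofReal (min ((1 + ‖ξ‖ ^ 2) ^ 9) (N : ℝ)) ≤ ENNReal.ofReal (N : ℝ) :=
              ENNReal.ofReal_le_ofReal (min_le_right _ _)
          _ = (N : ℝ≥0∞) := ENNReal.ofReal_natCast N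
    _ = (N : ℝ≥0∞) * ‖z‖ₑ ^ 2 := by
        rw [lintegral_const_mul' _ _ (ENNReal.natCast_ne_top N), lintegral_enorm_sq_fourierFn]
    _ < ∞ := ENNReal.mul_lt_top (ENNReal.natCast_lt_top N) (ENNReal.pow_lt_top enorm_lt_top)

/-- **The truncated energy is a pairing**: with `J_N = min((1+|D|²)⁹, N)` (a bounded scalar
Fourier multiplier), `‖⟪z, J_N z⟫‖ = I_N = ∫ min((1+|ξ|²)⁹, N) |ẑ|²` (Plancherel). -/
theorem enorm_inner_truncMultiplier (N : ℕ) (z : L2C) :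
    ‖⟪z, fourierMultiplier ((memLp_top_truncWeight N).toLp _) z⟫_ℂ‖ₑ =
      ∫⁻ ξ, ENNReal.ofReal (min ((1 + ‖ξ‖ ^ 2) ^ 9) (N : ℝ)) * ‖fourierFn z ξ‖ₑ ^ 2 := by
  set g : EuclideanSpace ℝ (Fin 3) → ℝ := fun ξ => min ((1 + ‖ξ‖ ^ 2) ^ 9) (N : ℝ) * ‖fourierFn z ξ‖ ^ 2
    with hg
  have hg0 : ∀ ξ, 0 ≤ g ξ := fun ξ => mul_nonneg (truncWeight_nonneg N ξ) (sq_nonneg _)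
  -- the pairing is the real integral `∫ g`
  have hinner : ⟪z, fourierMultiplier ((memLp_top_truncWeight N).toLp _) z⟫_ℂ = ((∫ ξ, g ξ : ℝ) : ℂ) := by
    rw [inner_fourierMultiplier_self, ← integral_complex_ofReal]
    refine integral_congr_ae ?_
    filter_upwards [MemLp.coeFn_toLp (memLp_top_truncWeight N)] with ξ hξ
    rw [hξ, hg]
    push_cast
    ring
  -- `g` is integrable (dominated by `N |ẑ|²`)
  have hsq : Integrable (fun ξ => ‖fourierFn z ξ‖ ^ 2) (volume : Measure (EuclideanSpace ℝ (Fin 3))) :=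
    (memLp_two_iff_integrable_sq_norm (aestronglyMeasurable_fourierFn z)).1 (Lp.memLp (𝓕 z : L2C))
  have hgm : AEStronglyMeasurable g volume :=
    (continuous_truncWeight N).aestronglyMeasurable.mul (hsq.1)
  have hgi : Integrable g volume := by
    refine (hsq.const_mul (N : ℝ)).mono' hgm (Eventually.of_forall fun ξ => ?_)
    rw [Real.norm_of_nonneg (hg0 ξ), hg]
    exact mul_le_mul_of_nonneg_right (min_le_right _ _) (sq_nonneg _)
  rw [hinner, ← ofReal_norm, Complex.norm_real, Real.norm_of_nonneg (integral_nonneg hg0),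
    ofReal_integral_eq_lintegral_ofReal hgi (Eventually.of_forall hg0)]
  refine lintegral_congr fun ξ => ?_
  rw [hg, ENNReal.ofReal_mul (truncWeight_nonneg N ξ), ← ofReal_norm (fourierFn z ξ),
    ENNReal.ofReal_pow (norm_nonneg _)]

/-- **The `H⁻⁹` norm of `J_N z` is controlled by the truncated energy**:
`‖J_N z‖_{H⁻⁹} ≤ I_N^{1/2}` (pointwise `(1+|ξ|²)⁻⁹ min((1+|ξ|²)⁹,N)² ≤ min((1+|ξ|²)⁹,N)`). -/
theorem eFourierSobolevNorm_truncMultiplier_le (N : ℕ) (z : L2C) :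
    eFourierSobolevNorm (-9) (fourierMultiplier ((memLp_top_truncWeight N).toLp _) z) ≤
      (∫⁻ ξ, ENNReal.ofReal (min ((1 + ‖ξ‖ ^ 2) ^ 9) (N : ℝ)) * ‖fourierFn z ξ‖ₑ ^ 2) ^ (1 / 2 : ℝ) := by
  rw [eFourierSobolevNorm_eq,
    sobolevWeightIntegral_congr_ae (fourierFn_fourierMultiplier_toLp (memLp_top_truncWeight N) z)]
  refine ENNReal.rpow_le_rpow (lintegral_mono fun ξ => ?_) (by norm_num)
  dsimp only
  set m : ℝ := min ((1 + ‖ξ‖ ^ 2) ^ 9) (N : ℝ) with hm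
  have hm0 : 0 ≤ m := truncWeight_nonneg N ξ
  have hρ : (0 : ℝ) < 1 + ‖ξ‖ ^ 2 := by positivity
  -- the scalar inequality `(1+|ξ|²)⁻⁹ m² ≤ m`
  have hkey : (1 + ‖ξ‖ ^ 2) ^ (-9 : ℝ) * m ^ 2 ≤ m := by
    rw [Real.rpow_neg hρ.le, show (9 : ℝ) = ((9 : ℕ) : ℝ) by norm_num, Real.rpow_natCast,
      inv_mul_le_iff₀ (pow_pos hρ 9)]
    calc m ^ 2 = m * m := sq m
      _ ≤ (1 + ‖ξ‖ ^ 2) ^ 9 * m := mul_le_mul_of_nonneg_right (min_le_left _ _) hm0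
  rw [enorm_smul, mul_pow, ← mul_assoc, ← ofReal_norm (((m : ℝ) : ℂ)), Complex.norm_real,
    Real.norm_of_nonneg hm0, ← ENNReal.ofReal_pow hm0, ← ENNReal.ofReal_mul (by positivity)]
  exact mul_le_mul' (ENNReal.ofReal_le_ofReal hkey) le_rfl

/-- **Monotone convergence for the truncated energies**:
`∫ (1+|ξ|²)⁹ |ẑ|² = ⨆_N ∫ min((1+|ξ|²)⁹, N) |ẑ|²`, i.e. `‖z‖²_{H⁹} = sup_N I_N`. -/
theorem sobolevWeightIntegral_nine_eq_iSup (z : L2C) :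
    sobolevWeightIntegral 9 (fourierFn z) =
      ⨆ N : ℕ, ∫⁻ ξ, ENNReal.ofReal (min ((1 + ‖ξ‖ ^ 2) ^ 9) (N : ℝ)) * ‖fourierFn z ξ‖ₑ ^ 2 := by
  have hmeas : ∀ N : ℕ, AEMeasurable
      (fun ξ => ENNReal.ofReal (min ((1 + ‖ξ‖ ^ 2) ^ 9) (N : ℝ)) * ‖fourierFn z ξ‖ₑ ^ 2) volume :=
    fun N => (continuous_truncWeight N).measurable.ennreal_ofReal.aemeasurable.mul
      ((aestronglyMeasurable_fourierFn z).enorm.pow_const 2)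
  have hmono : ∀ᵐ ξ ∂(volume : Measure (EuclideanSpace ℝ (Fin 3))), Monotone fun N : ℕ =>
      ENNReal.ofReal (min ((1 + ‖ξ‖ ^ 2) ^ 9) (N : ℝ)) * ‖fourierFn z ξ‖ₑ ^ 2 :=
    Eventually.of_forall fun ξ N M hNM => mul_le_mul'
      (ENNReal.ofReal_le_ofReal (min_le_min_left _ (Nat.cast_le.2 hNM))) le_rfl
  rw [← lintegral_iSup' hmeas hmono]
  unfold sobolevWeightIntegral
  refine lintegral_congr fun ξ => ?_
  rw [← ENNReal.iSup_mul]
  congr 1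
  have h9 : ((1 + ‖ξ‖ ^ 2) ^ (9 : ℝ) : ℝ) = (1 + ‖ξ‖ ^ 2) ^ 9 := by
    rw [show (9 : ℝ) = ((9 : ℕ) : ℝ) by norm_num, Real.rpow_natCast]
  rw [h9]
  refine le_antisymm ?_ (iSup_le fun N => ENNReal.ofReal_le_ofReal (min_le_left _ _))
  refine le_iSup_of_le ⌈(1 + ‖ξ‖ ^ 2) ^ 9⌉₊ (le_of_eq ?_)
  rw [min_eq_left (Nat.le_ceil _)]

/-- **The `H⁹` bootstrap**: if `z ∈ L²` is divergence free and `|⟪z, w⟫| ≤ K ‖w‖_{H⁻⁹}` for every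
divergence-free `w ∈ L²(ℝ³; ℂ³)`, then `z ∈ H⁹` with `‖z‖_{H⁹} ≤ K`. -/
theorem eFourierSobolevNorm_nine_le_of_inner_bound {z : L2C} (hz : IsFourierDivFree z) {K : ℝ≥0∞}
    (h : ∀ w : L2C, IsFourierDivFree w → ‖⟪z, w⟫_ℂ‖ₑ ≤ K * eFourierSobolevNorm (-9) w) :
    eFourierSobolevNorm 9 z ≤ K := by
  -- each truncated energy is at most `K²`
  have hI : ∀ N : ℕ,
      ∫⁻ ξ, ENNReal.ofReal (min ((1 + ‖ξ‖ ^ 2) ^ 9) (N : ℝ)) * ‖fourierFn z ξ‖ₑ ^ 2 ≤ K ^ 2 := by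
    intro N
    set I : ℝ≥0∞ := ∫⁻ ξ, ENNReal.ofReal (min ((1 + ‖ξ‖ ^ 2) ^ 9) (N : ℝ)) * ‖fourierFn z ξ‖ₑ ^ 2
      with hIdef
    set J : L2C := fourierMultiplier ((memLp_top_truncWeight N).toLp _) z with hJ
    have hItop : I ≠ ∞ := (truncEnergy_lt_top N z).ne
    have h1 : I ≤ K * I ^ (1 / 2 : ℝ) :=
      calc I = ‖⟪z, J⟫_ℂ‖ₑ := (enorm_inner_truncMultiplier N z).symm
        _ ≤ K * eFourierSobolevNorm (-9) J := h J (hz.fourierMultiplier _)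
        _ ≤ K * I ^ (1 / 2 : ℝ) := mul_le_mul' le_rfl (eFourierSobolevNorm_truncMultiplier_le N z)
    by_cases hI0 : I = 0
    · rw [hI0]; exact zero_le
    have hs0 : I ^ (1 / 2 : ℝ) ≠ 0 := by
      intro h0
      rcases ENNReal.rpow_eq_zero_iff.1 h0 with ⟨h0', _⟩ | ⟨_, h0'⟩
      · exact hI0 h0'
      · norm_num at h0'
    have hstop : I ^ (1 / 2 : ℝ) ≠ ∞ := ENNReal.rpow_ne_top_of_nonneg (by norm_num) hItop
    have hII : I = I ^ (1 / 2 : ℝ) * I ^ (1 / 2 : ℝ) := by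
      rw [← ENNReal.rpow_add _ _ hI0 hItop]; norm_num
    have hsK : I ^ (1 / 2 : ℝ) ≤ K := by
      refine (ENNReal.mul_le_mul_iff_left hs0 hstop).1 ?_
      calc I ^ (1 / 2 : ℝ) * I ^ (1 / 2 : ℝ) = I := hII.symm
        _ ≤ K * I ^ (1 / 2 : ℝ) := h1
    calc I = (I ^ (1 / 2 : ℝ)) ^ 2 := by
          rw [← ENNReal.rpow_natCast, ← ENNReal.rpow_mul]; norm_num
      _ ≤ K ^ 2 := by gcongr
  -- pass to the limit `N → ∞`
  rw [eFourierSobolevNorm_eq, sobolevWeightIntegral_nine_eq_iSup]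
  calc (⨆ N : ℕ, ∫⁻ ξ, ENNReal.ofReal (min ((1 + ‖ξ‖ ^ 2) ^ 9) (N : ℝ)) * ‖fourierFn z ξ‖ₑ ^ 2) ^
        (1 / 2 : ℝ) ≤ (K ^ 2) ^ (1 / 2 : ℝ) := ENNReal.rpow_le_rpow (iSup_le hI) (by norm_num)
    _ = K := by rw [← ENNReal.rpow_natCast, ← ENNReal.rpow_mul]; norm_num

/-! ### Conjugates and real parts: Sobolev norms, divergence, additivity -/

/-- **Conjugation preserves every Sobolev norm**: `‖w̄‖_{H^s} = ‖w‖_{H^s}`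
(`𝓕(w̄) = \overline{ŵ(-·)}`, the weight is even). -/
theorem eFourierSobolevNorm_conjL2 (s : ℝ) (w : L2C) :
    eFourierSobolevNorm s (conjL2 w) = eFourierSobolevNorm s w := by
  rw [eFourierSobolevNorm_eq, eFourierSobolevNorm_eq, sobolevWeightIntegral_congr_ae (fourierFn_conjL2 w),
    sobolevWeightIntegral_conj3 s (fun ξ => fourierFn w (-ξ)), sobolevWeightIntegral_reflect]

/-- **Taking real parts does not increase Sobolev norms**: `‖Re w‖_{H^s} ≤ ‖w‖_{H^s}`
(`Re w = (w + w̄)/2` and `‖w̄‖_{H^s} = ‖w‖_{H^s}`). -/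
theorem eFourierSobolevNorm_reL2_le (s : ℝ) (w : L2C) :
    eFourierSobolevNorm s (reL2 w) ≤ eFourierSobolevNorm s w := by
  have hsmul : eFourierSobolevNorm s (((2 : ℂ)⁻¹) • (w + conjL2 w)) =
      ‖(2 : ℂ)⁻¹‖ₑ * eFourierSobolevNorm s (w + conjL2 w) := by
    rw [eFourierSobolevNorm_eq, eFourierSobolevNorm_eq,
      sobolevWeightIntegral_congr_ae (fourierFn_smul _ _), sobolevWeightIntegral_smul,
      ENNReal.mul_rpow_of_nonneg _ _ (by norm_num : (0 : ℝ) ≤ 1 / 2)]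
    congr 1
    rw [← ENNReal.rpow_natCast, ← ENNReal.rpow_mul]
    norm_num
  have h2 : ‖(2 : ℂ)⁻¹‖ₑ = 2⁻¹ := by
    rw [← ofReal_norm, norm_inv, Complex.norm_ofNat, ENNReal.ofReal_inv_of_pos two_pos,
      ENNReal.ofReal_ofNat]
  unfold reL2
  rw [hsmul, h2]
  calc 2⁻¹ * eFourierSobolevNorm s (w + conjL2 w)
      ≤ 2⁻¹ * (eFourierSobolevNorm s w + eFourierSobolevNorm s (conjL2 w)) :=
        mul_le_mul' le_rfl (eFourierSobolevNorm_add_le s w (conjL2 w))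
    _ = eFourierSobolevNorm s w := by
        rw [eFourierSobolevNorm_conjL2, ← two_mul, ← mul_assoc,
          ENNReal.inv_mul_cancel two_ne_zero ENNReal.ofNat_ne_top, one_mul]

/-- **Conjugation preserves divergence-freeness** (`ξ · \overline{ŵ(-ξ)} = \overline{ξ · ŵ(-ξ)}`). -/
theorem isFourierDivFree_conjL2 {w : L2C} (hw : IsFourierDivFree w) : IsFourierDivFree (conjL2 w) := by
  unfold IsFourierDivFree
  have hq := (Measure.measurePreserving_neg (volume : Measure (EuclideanSpace ℝ (Fin 3)))).quasiMeasurePreserving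
  filter_upwards [hq.ae hw, fourierFn_conjL2 w] with ξ h1 h2
  have h1' : cdot (Literature.Analysis.FunctionSpaces.EuclideanSpace.complexify ξ) (fourierFn w (-ξ)) = 0 := by
    rw [map_neg, cdot_neg_left, neg_eq_zero] at h1
    exact h1
  rw [h2, cdot_conj3_right, conj3_complexify, h1', map_zero]

/-- **Real parts of divergence-free fields are divergence free.** -/
theorem isFourierDivFree_reL2 {w : L2C} (hw : IsFourierDivFree w) : IsFourierDivFree (reL2 w) :=
  (hw.add (isFourierDivFree_conjL2 hw)).smul _

/-- `Re` is additive. -/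
theorem reL2_add (x y : L2C) : reL2 (x + y) = reL2 x + reL2 y := by
  simp only [reL2, conjL2_add, smul_add]
  abel

/-- `Re` commutes with real scalars: `Re (c w) = c Re w` for `c ∈ ℝ`. -/
theorem reL2_smul_real (c : ℝ) (x : L2C) : reL2 ((c : ℂ) • x) = (c : ℂ) • reL2 x := by
  simp only [reL2, conjL2_smul, Complex.conj_ofReal, smul_add, smul_smul, mul_comm]

end Summit.NavierStokesRegularity.NavierStokesRegularity.Theorems.PerpetualPumpThesis.B

namespace Summit.NavierStokesRegularity.NavierStokesRegularity.Theorems.PerpetualPumpThesis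

open Literature.Analysis.FluidPDE Literature.Analysis.FluidPDE.Tao2016
open Literature.Analysis.FunctionSpaces (eFourierSobolevNorm)

/-- **Part S of stub B (registered sub-goal `stub_bilinearOperator_S`)**: the `H⁹` bootstrap —
a divergence-free `z ∈ L²(ℝ³; ℂ³)` whose inner products against divergence-free test fields are
controlled by their `H⁻⁹` norms lies in `H⁹`, with `‖z‖_{H⁹}` at most the constant. -/
theorem stub_bilinearOperator_S : ∀ (z : L2C) (K : ENNReal), IsFourierDivFree z → (∀ w : L2C, IsFourierDivFree w → ‖inner ℂ z w‖ₑ ≤ K * eFourierSobolevNorm (-9) w) → eFourierSobolevNorm 9 z ≤ K :=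
  fun _ _ hz h => B.eFourierSobolevNorm_nine_le_of_inner_bound hz h

end Summit.NavierStokesRegularity.NavierStokesRegularity.Theorems.PerpetualPumpThesis
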